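import Summits.QuantumFields.BalabanUV.T4Continuum.Support.NE3WeightedCoercivityTransfer
import Summits.QuantumFields.BalabanUV.T4Continuum.Support.NE3ProjTangentLandauCoercive
import HarnessLib

/-!
# T⁴ programme, node NE3 — THE CURVED WALL OF (ML_w) TYPED BY NAME: the η-weighted SLICE POINCARÉ inequality (P♮)_W as a hypothesis
# SHAPE, its FLAT DISCHARGE on the chart's min-norm slice (H5b, by name) and its two CONSUMERS (the (ML_w) transfer at the fixed and at
# the moving configuration, by name)

NE3 (node U1b), row NE3 OWNER `b2b-balaban-t4-ne3-p1` (gen 22), ruling ρ-g22-2 (journal l.17514) (V1): «THE WALL IS ONE STATEMENT».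

WHAT.  The only analytic leaf left between the chart composition of the local half of NE3 and the tree is, per background `W` and
complement slice `T(W)` of the corner-trivial gauge orbit in `ker d(avg^k)_W`:

  **(P♮)_W   `SlicePoincare L k W T C F :⟺ ∀ Y ∈ T, ((L^k)⁻¹)²·dirSq Y F ≤ C·curlSq W Y F`**

— exactly the hypothesis `hP` of `NE3WeightedCoercivityTransfer.weightedTangentCoercive_of_weightedPoincare_periodBox` and of
`…_vary_of_weightedPoincare` (p219420).  This file NAMES it (a hypothesis SHAPE, asserted for no curved configuration), DISCHARGES it at
the FLAT background on the chart's min-norm slice `projTangentLandau L N k` with the N-FREE, k-FREE constant of the crew's chain H1–H5b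
(`NE3ProjTangentLandauCoercive.weightedPoincare_projTangentLandau`, p226727 — by name), and re-exports the two transfers with the shape
as their hypothesis, so that every consumer and the curved supplier rows K0–K6 (design `HOME/t4/b2b-balaban-t4-ne3-p1/g22/D-ne3p1-g22-1.md`,
route H♮: covariant Hodge split on the frame-free slice + spectral cut `NE3SpectralCut{,Gram}`) meet at ONE name.
NUMERICS (evidence, not a hypothesis; F-ne3p1-g22-1, kit j101589∕j101697∕j101702, two independent engines): the best constant is
`C* ≤ 0.166` uniformly over 324 SU(2) backgrounds (flat, twists, small and large smooth curvature, coarse-abelian∕fine-nonabelian), N ≤ 4,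
k ≤ 5, d ∈ {2,3,4}; the flat kernel constant is `card n·(9 + 2·2^{d−1} + 864·d·Dfp d L)`.

CONTENT ([folklore]; 0 sorry): the SHAPE `SlicePoincare` (one `def … : Prop`, tagged, asserted for nothing), `slicePoincare_mono` ∕ `_anti`,
**`slicePoincare_flat_projTangentLandau`** (discharge at `W = flatCfg`), **`weightedTangentCoercive_of_slicePoincare`** and
**`weightedTangentCoercive_vary_of_slicePoincare`** (the consumers, verbatim re-exports of p219420 with `hP := the shape`).

HONEST FRAMING.  A hypothesis shape + bookkeeping; (P♮)_W at `W = cavg^k U_B`, (ML_w) at the curved background, T-E_w and NE3 are NOT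
proved; nothing about Bałaban's minimisers is asserted; spine PROVED 0∕9; finite T⁴ rung (B)+1 — NOT infinite volume, NOT mass gap, NOT
BetaPertH, NOT Clay.  ABSOLUTE RULE kept (context only: [Balaban1985PropagatorsII] Thm 3.3 (3.46) is an η-weighted coercivity statement in
print; nothing printed is a hypothesis here).  PLACEMENT: `Summits/QuantumFields/BalabanUV/`; imports accepted modules only.
-/

set_option autoImplicit false

open scoped BigOperators Matrix.Norms.L2Operator
open Finset

namespace Summit.QuantumFields.BalabanUV.T4Continuum.NE3SlicePoincareShape

open Literature.MathematicalPhysics.QuantumFieldTheory.Balaban1983to89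
open B7Prop1Explicit
open T4AveragingDeficitWall (IsUnitaryCfg IsSkewDir curlSq dirSq fhol vary)
open T4AveragingDeficitWallBoundary (periodBox)
open AveragingDeficitPeriodicCounting (IsPeriodicDir)
open MinimalActionWitness (flatCfg)
open NE3HessShapes (plaqsOf)
open NE3EnergyWeightedShapes (WeightedTangentCoercive)
open NE3WeightedCoercivityTransfer (weightedTangentCoercive_of_weightedPoincare_periodBox
  weightedTangentCoercive_vary_of_weightedPoincare)
open NE3ProjTangentLandauPoincare (projTangentLandau)
open NE3ProjTangentLandauCoercive (weightedPoincare_projTangentLandau)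
open NE3FramePotBound (Dfp)

noncomputable section

variable {d : ℕ} {n : Type*} [Fintype n] [DecidableEq n]

/-! ## §1 The shape -/

/-- **(P♮)_W — THE η-WEIGHTED SLICE POINCARÉ INEQUALITY** at the background `W`, on the direction set `T`, constant `C`, over the site
set `F`: `∀ Y ∈ T, ((L^k)⁻¹)²·dirSq Y F ≤ C·curlSq W Y F`.  The ONE located analytic leaf of the (ML_w) row at a curved background
(owner ruling ρ-g22-2 (V1)); a hypothesis SHAPE, asserted for nothing.  Printed context: B9 Thm 3.3 (3.46) ∕ B6 (2.153) are η-weighted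
coercivity bounds in Bałaban's own gauges. [folklore] -/
@[folklore]
def SlicePoincare (L k : ℕ) (W : Site d → Fin d → (Matrix n n ℂ)ˣ) (T : Set (Site d → Fin d → Matrix n n ℂ)) (C : ℝ)
    (F : Finset (Site d)) : Prop :=
  ∀ Y ∈ T, (((L : ℝ) ^ k)⁻¹) ^ 2 * dirSq Y F ≤ C * curlSq W Y F

/-- Monotonicity in the constant. [folklore] -/
theorem slicePoincare_mono {L k : ℕ} {W : Site d → Fin d → (Matrix n n ℂ)ˣ} {T : Set (Site d → Fin d → Matrix n n ℂ)}
    {C C' : ℝ} {F : Finset (Site d)} (h : SlicePoincare L k W T C F) (hC : C ≤ C') : SlicePoincare L k W T C' F := by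
  intro Y hY
  refine (h Y hY).trans (mul_le_mul_of_nonneg_right hC ?_)
  unfold curlSq
  positivity

/-- Anti-monotonicity in the direction set. [folklore] -/
theorem slicePoincare_anti {L k : ℕ} {W : Site d → Fin d → (Matrix n n ℂ)ˣ} {T T' : Set (Site d → Fin d → Matrix n n ℂ)}
    {C : ℝ} {F : Finset (Site d)} (h : SlicePoincare L k W T C F) (hT : T' ⊆ T) : SlicePoincare L k W T' C F :=
  fun Y hY => h Y (hT hY)

/-- Non-vacuity: the shape holds on the zero direction set with any constant. [folklore] -/
theorem slicePoincare_singleton_zero (L k : ℕ) (W : Site d → Fin d → (Matrix n n ℂ)ˣ) {C : ℝ} (hC : 0 ≤ C)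
    (F : Finset (Site d)) : SlicePoincare L k W {fun _ _ => 0} C F := by
  intro Y hY
  rw [Set.mem_singleton_iff] at hY
  subst hY
  have h0 : dirSq (fun (_ : Site d) (_ : Fin d) => (0 : Matrix n n ℂ)) F = 0 := by
    unfold dirSq; simp
  rw [h0, mul_zero]
  unfold curlSq
  positivity

/-! ## §2 The flat discharge on the chart's min-norm slice (crew chain H1–H5b, by name) -/

/-- **(P♮) AT THE FLAT BACKGROUND ON THE CHART'S MIN-NORM SLICE, N-FREE, k-FREE** (`d ≥ 3`, `L ≥ 2`, `N, k ≥ 1`):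
`SlicePoincare L k flatCfg (projTangentLandau L N k) (card n·(9 + 2·2^{d−1} + 72·d·(12·Dfp d L))) (periodBox (N·L^k))` —
`NE3ProjTangentLandauCoercive.weightedPoincare_projTangentLandau` BY NAME (H1 `NE3FlatHodgeSplit`, H2 `NE3HodgeCoexactPoincare{,Eta,End}`,
H3 `NE3CoarseInterpolant{,Socket}`, H4 `NE3FramePotBound{,Complex}`, H5a `NE3SlicePoincareAssembly`, H5b `NE3ProjTangentLandau{Poincare,Coercive}`).
[folklore] -/
theorem slicePoincare_flat_projTangentLandau [Nonempty n] (hd : 3 ≤ d) {L N k : ℕ} (hL : 2 ≤ L) (hN : 1 ≤ N) (hk : 1 ≤ k) :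
    SlicePoincare L k (flatCfg (d := d) (n := n)) (projTangentLandau L N k)
      (Fintype.card n * (9 + 2 * (2 : ℝ) ^ (d - 1) + 72 * d * (12 * Dfp d L))) (periodBox (d := d) (N * L ^ k)) :=
  weightedPoincare_projTangentLandau hd hL hN hk

/-! ## §3 The consumers: (P♮)_W ⟹ (ML_w), at the fixed and at the moving configuration (p219420, by name) -/

/-- **(P♮)_U ⟹ (ML_w) AT THE SAME BACKGROUND** (`NE3WeightedCoercivityTransfer.weightedTangentCoercive_of_weightedPoincare_periodBox` with
`hP := the shape`): at a unitary `U` with windowed plaquette radius `a`, on a skew periodic direction set `T`,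
`SlicePoincare L k U T CP (periodBox M)` and `28·d·a·CP·(L^k)² ≤ 1∕card n` give
`WeightedTangentCoercive L k U T ((1∕card n − 28·d·a·CP·(L^k)²)∕(1 + CP)) (periodBox M)`. [folklore] -/
theorem weightedTangentCoercive_of_slicePoincare [Nonempty n] {L : ℕ} (hL : 1 ≤ L) (k : ℕ)
    {U : Site d → Fin d → (Matrix n n ℂ)ˣ} (hU : IsUnitaryCfg U) {a : ℝ} (ha : 0 ≤ a) {M : ℕ} (hM : 1 ≤ M)
    (hUa : ∀ p ∈ plaqsOf (periodBox M), ‖((fhol U p : (Matrix n n ℂ)ˣ) : Matrix n n ℂ) - 1‖ ≤ a)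
    {T : Set (Site d → Fin d → Matrix n n ℂ)} (hskew : ∀ Y ∈ T, IsSkewDir Y)
    (hper : ∀ Y ∈ T, IsPeriodicDir Y (M : ℤ)) {CP : ℝ} (hCP : 0 ≤ CP)
    (hP : SlicePoincare L k U T CP (periodBox M))
    (hsmall : 28 * (d : ℝ) * a * CP * ((L : ℝ) ^ k) ^ 2 ≤ 1 / (Fintype.card n : ℝ)) :
    WeightedTangentCoercive L k U T
      ((1 / (Fintype.card n : ℝ) - 28 * (d : ℝ) * a * CP * ((L : ℝ) ^ k) ^ 2) / (1 + CP)) (periodBox M) :=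
  weightedTangentCoercive_of_weightedPoincare_periodBox hL k hU ha hM hUa hskew hper hCP hP hsmall

/-- **(P♮)_U ⟹ (ML_w) AT THE MOVING CONFIGURATION `U·e^X`** (`…_vary_of_weightedPoincare` with `hP := the shape`) — exactly the
hypothesis `hML` the chart's `coer` socket consumes (`NE3EnergyChartLeavesSockets.coer_of_weightedTangentCoercive_vary`). [folklore] -/
theorem weightedTangentCoercive_vary_of_slicePoincare [Nonempty n] {L : ℕ} (hL : 1 ≤ L) (k : ℕ)
    {U : Site d → Fin d → (Matrix n n ℂ)ˣ} (hU : IsUnitaryCfg U) {X : Site d → Fin d → Matrix n n ℂ} (hX : IsSkewDir X)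
    {α : ℝ} (hα : 0 ≤ α) (hXα : ∀ x κ, ‖X x κ‖ ≤ α) {M : ℕ} (hM : 1 ≤ M)
    {T : Set (Site d → Fin d → Matrix n n ℂ)} (hskew : ∀ Y ∈ T, IsSkewDir Y) (hper : ∀ Y ∈ T, IsPeriodicDir Y (M : ℤ))
    {a' : ℝ} (ha' : 0 ≤ a')
    (hsmall' : ∀ p ∈ plaqsOf (periodBox M), ‖((fhol (vary U X 1) p : (Matrix n n ℂ)ˣ) : Matrix n n ℂ) - 1‖ ≤ a')
    {CP : ℝ} (hCP : 0 ≤ CP) (hP : SlicePoincare L k U T CP (periodBox M))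
    (hreg₁ : CP * (24 * Real.sqrt d * (Real.exp α - 1) * (L : ℝ) ^ k) ^ 2 ≤ 1 / 4)
    (hreg₂ : 112 * (d : ℝ) * a' * CP * ((L : ℝ) ^ k) ^ 2 ≤ 1 / (2 * (Fintype.card n : ℝ))) :
    WeightedTangentCoercive L k (vary U X 1) T (1 / (2 * (Fintype.card n : ℝ) * (1 + 4 * CP))) (periodBox M) :=
  weightedTangentCoercive_vary_of_weightedPoincare hL k hU hX hα hXα hM hskew hper ha' hsmall' hCP hP hreg₁ hreg₂

end

end Summit.QuantumFields.BalabanUV.T4Continuum.NE3SlicePoincareShape
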